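import Summits.QuantumFields.YangMills.Theorems.LuscherReductionTwistedTraceScalingBTKineticSquares
import Summits.QuantumFields.YangMills.Theorems.LuscherReductionTwistedTraceScalingSlowShadow
import HarnessLib

/-!
# The slow WINDOW in quaternion terms: `orbitDist u < δ ⇒ ‖q(u_k) − 1‖ ≤ δ`, the relative rotation stays in the upper hemisphere, the one-site action is `O(δ⁴)`,
# the one-site kernel of a far pair is `e^{B(6 − d²)}`, and the gauge core lies in the upper hemisphere with pinned colour sum
# (lane A of S-BASE, crux `TwistedTraceScaling` stmt-QuantumFields-20203, C4-CORE, the (B-T) pen; design note `pub/ym-fleet/ym-luscher-20007-p1/COARSE-DESIGN.md` §25.9)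

* `norm_su2Quat_sub_one_le_orbitDist` — one site: `‖q(u_k) − 1‖ ≤ orbitDist u`;
* `abs_vecPart_le_norm_sub_one`, `sum_sq_vecPart_le_norm_sub_one_sq`, `norm_vecPart_le_norm_sub_one`, `scalarPart_nonneg_of_norm_sub_one_le` — quaternion sizes from `‖q − 1‖`;
* `norm_su2Quat_mul_inv_sub_one` — `‖q(AB⁻¹) − 1‖ = ‖q(A) − q(B)‖`; `scalarPart_mul_inv_nonneg` — `‖q(A) − q(B)‖ ≤ √2 ⇒ u₀(AB⁻¹) ≥ 0`;
* ★ `wilsonAction_one_site_le` — `S₁(u) ≤ 12δ⁴` when `‖q(u_k) − 1‖ ≤ δ` (plaquette holonomies of the one-site torus are COMMUTATORS, `‖[a,b]‖ ≤ 2‖a−1‖‖b−1‖`);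
* ★ `transferKernel_one_site_le_exp` — `K₁^{(B)}(u,u') ≤ exp(B(6 − ‖q(u_k) − q(u'_k)‖²))` for every `k`, and `transferKernel_one_site_one_one` (`K₁^{(B)}(1,1) = e^{6B}`);
* `abs_im_le_norm_sub_smul_one`, `norm_sum_vecPart_le` — the colour sum's vector part is bounded by `‖S − ‖S‖·1‖` (pinning feeds `abs_offX_le`'s `Γ`).
HONEST FRAMING: elementary bookkeeping for a stub of a child of the CONDITIONAL reduction route R2b1; C4-CORE OPEN; not infinite volume, not a gap, not Clay.
-/

set_option autoImplicit false

noncomputable section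

open MeasureTheory Filter Topology Real
open scoped BigOperators Matrix Quaternion
open Literature.MathematicalPhysics.QuantumFieldTheory
open Literature.MathematicalPhysics.QuantumLattice

namespace Summit.QuantumFields.YangMills.Theorems.FemtoTransferGap.TwoLattice.ConstTube

open Summit.QuantumFields.YangMills.Theorems.FemtoTransferGap
open Summit.QuantumFields.YangMills.Theorems.FemtoTransferGap.TwoLattice
open Summit.QuantumFields.YangMills.Theorems.FemtoTransferGap.TwoLattice.Avg

variable {L : ℕ} [NeZero L]

/-! ## §1 Quaternion sizes from `‖q − 1‖` -/

omit [NeZero L] in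
/-- One site: `‖q(u_k) − 1‖ ≤ orbitDist u`. [folklore] -/
theorem norm_su2Quat_sub_one_le_orbitDist (u : GaugeConfig 3 1 SU2) (e : Edge 3 1) : ‖su2Quat (u e) - 1‖ ≤ orbitDist u := by
  have h := norm_su2Quat_sub_le (u e) 1
  rw [su2Quat_one, OneMemClass.coe_one] at h
  exact h.trans (frobNorm_sub_one_le_orbitDist u e)

omit [NeZero L] in
/-- Each vector component is at most `‖q − 1‖`. [folklore] -/
theorem abs_vecPart_le_norm_sub_one (A : SU2) (c : Fin 3) : |vecPart A c| ≤ ‖su2Quat A - 1‖ := by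
  have h : vecPart A c ^ 2 ≤ ‖su2Quat A - 1‖ ^ 2 := by
    rw [sq (‖su2Quat A - 1‖), ← Quaternion.normSq_eq_norm_mul_self, Quaternion.normSq_def']
    simp only [Quaternion.re_sub, Quaternion.imI_sub, Quaternion.imJ_sub, Quaternion.imK_sub, Quaternion.re_one, Quaternion.imI_one, Quaternion.imJ_one,
      Quaternion.imK_one, sub_zero]
    fin_cases c <;> simp [vecPart] <;> nlinarith [sq_nonneg ((su2Quat A).re - 1), sq_nonneg (su2Quat A).imI, sq_nonneg (su2Quat A).imJ, sq_nonneg (su2Quat A).imK]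
  exact abs_le_of_sq_le_sq' h (norm_nonneg _) |>.2 |> fun h2 => abs_le.mpr ⟨(abs_le_of_sq_le_sq' h (norm_nonneg _)).1, h2⟩

omit [NeZero L] in
/-- `Σ_c u⃗_c² ≤ ‖q(u) − 1‖²`. [folklore] -/
theorem sum_sq_vecPart_le_norm_sub_one_sq (A : SU2) : ∑ c, vecPart A c ^ 2 ≤ ‖su2Quat A - 1‖ ^ 2 := by
  rw [sq (‖su2Quat A - 1‖), ← Quaternion.normSq_eq_norm_mul_self, Quaternion.normSq_def']
  simp only [Quaternion.re_sub, Quaternion.imI_sub, Quaternion.imJ_sub, Quaternion.imK_sub, Quaternion.re_one, Quaternion.imI_one, Quaternion.imJ_one,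
    Quaternion.imK_one, sub_zero, Fin.sum_univ_three, vecPart, Matrix.cons_val_zero, Matrix.cons_val_one, Matrix.cons_val]
  nlinarith [sq_nonneg ((su2Quat A).re - 1)]

omit [NeZero L] in
/-- The sup norm of the vector part is at most `‖q − 1‖`. [folklore] -/
theorem norm_vecPart_le_norm_sub_one (A : SU2) : ‖vecPart A‖ ≤ ‖su2Quat A - 1‖ :=
  (pi_norm_le_iff_of_nonneg (norm_nonneg _)).mpr fun c => by rw [Real.norm_eq_abs]; exact abs_vecPart_le_norm_sub_one A c

omit [NeZero L] in
/-- `‖q − 1‖ ≤ 1 ⇒ u₀ ≥ 0`. [folklore] -/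
theorem scalarPart_nonneg_of_norm_sub_one_le {A : SU2} (h : ‖su2Quat A - 1‖ ≤ 1) : 0 ≤ scalarPart A := by
  have h1 : |(su2Quat A).re - 1| ≤ ‖su2Quat A - 1‖ := by
    have h2 : ((su2Quat A).re - 1) ^ 2 ≤ ‖su2Quat A - 1‖ ^ 2 := by
      rw [sq (‖su2Quat A - 1‖), ← Quaternion.normSq_eq_norm_mul_self, Quaternion.normSq_def']
      simp only [Quaternion.re_sub, Quaternion.imI_sub, Quaternion.imJ_sub, Quaternion.imK_sub, Quaternion.re_one, Quaternion.imI_one, Quaternion.imJ_one,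
        Quaternion.imK_one, sub_zero]
      nlinarith [sq_nonneg (su2Quat A).imI, sq_nonneg (su2Quat A).imJ, sq_nonneg (su2Quat A).imK]
    exact abs_le_of_sq_le_sq' h2 (norm_nonneg _) |> fun h3 => abs_le.mpr h3
  have := (abs_le.mp h1).1
  show 0 ≤ (su2Quat A).re
  linarith

omit [NeZero L] in
/-- `‖q(AB⁻¹) − 1‖ = ‖q(A) − q(B)‖`. [folklore] -/
theorem norm_su2Quat_mul_inv_sub_one (A B : SU2) : ‖su2Quat (A * B⁻¹) - 1‖ = ‖su2Quat A - su2Quat B‖ := by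
  have hmul := @Literature.MathematicalPhysics.QuantumFieldTheory.Balaban1983to89.T4HaarSU2Translate.su2Quat_mul
  have h1 : su2Quat B⁻¹ * su2Quat B = 1 := by rw [← hmul, inv_mul_cancel, su2Quat_one]
  have e : su2Quat A - su2Quat B = (su2Quat (A * B⁻¹) - 1) * su2Quat B := by
    rw [hmul, sub_mul, mul_assoc, h1, mul_one, one_mul]
  rw [e, norm_mul, norm_su2Quat, mul_one]

omit [NeZero L] in
/-- `‖q(A) − q(B)‖ ≤ √2 ⇒ u₀(AB⁻¹) ≥ 0`. [folklore] -/
theorem scalarPart_mul_inv_nonneg {A B : SU2} (h : ‖su2Quat A - su2Quat B‖ ^ 2 ≤ 2) : 0 ≤ scalarPart (A * B⁻¹) := by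
  rw [scalarPart_mul_inv_eq_one_sub]; linarith

/-! ## §2 The one-site action is quartic in the window radius -/

omit [NeZero L] in
/-- `‖ab − ba‖ ≤ 2‖a − 1‖‖b − 1‖` in `ℍ`. [folklore] -/
theorem norm_comm_le (a b : ℍ) : ‖a * b - b * a‖ ≤ 2 * ‖a - 1‖ * ‖b - 1‖ := by
  have e : a * b - b * a = (a - 1) * (b - 1) - (b - 1) * (a - 1) := by noncomm_ring
  rw [e]
  calc ‖(a - 1) * (b - 1) - (b - 1) * (a - 1)‖ ≤ ‖(a - 1) * (b - 1)‖ + ‖(b - 1) * (a - 1)‖ := norm_sub_le _ _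
    _ = 2 * ‖a - 1‖ * ‖b - 1‖ := by rw [norm_mul, norm_mul]; ring

omit [NeZero L] in
/-- The plaquette term is the squared quaternion distance of the holonomy from `1`: `2 − Re tr(h) = ‖q(h) − 1‖²`. [folklore] -/
theorem two_sub_re_trace_eq (h : SU2) : 2 - ((su2Rep h).trace).re = ‖su2Quat h - 1‖ ^ 2 := by
  have e := re_trace_su2Rep_mul_inv_eq_norm h 1
  rw [inv_one, mul_one, su2Quat_one] at e
  linarith

omit [NeZero L] in
/-- A commutator holonomy: `‖q(aba⁻¹b⁻¹) − 1‖ ≤ 2‖q(a) − 1‖‖q(b) − 1‖`. [folklore] -/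
theorem norm_su2Quat_comm_sub_one_le (a b : SU2) : ‖su2Quat (a * b * a⁻¹ * b⁻¹) - 1‖ ≤ 2 * ‖su2Quat a - 1‖ * ‖su2Quat b - 1‖ := by
  have hmul := @Literature.MathematicalPhysics.QuantumFieldTheory.Balaban1983to89.T4HaarSU2Translate.su2Quat_mul
  have e1 : a * b * a⁻¹ * b⁻¹ = (a * b) * (b * a)⁻¹ := by group
  rw [e1, norm_su2Quat_mul_inv_sub_one, hmul, hmul]
  exact norm_comm_le _ _

omit [NeZero L] in
/-- ★ **One-site action in the window**: `‖q(u_k) − 1‖ ≤ δ` for all `k` ⇒ `S₁(u) ≤ 12δ⁴`. [cite: Luscher1983, §2] -/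
theorem wilsonAction_one_site_le (u : GaugeConfig 3 1 SU2) {δ : ℝ} (hu : ∀ e : Edge 3 1, ‖su2Quat (u e) - 1‖ ≤ δ) :
    wilsonAction su2Rep u ≤ 12 * δ ^ 4 := by
  have hδ0 : 0 ≤ δ := (norm_nonneg _).trans (hu default)
  unfold wilsonAction
  have hp : ∀ p : Plaquette 3 1, ((2 : ℕ) : ℝ) - ((su2Rep (plaquetteHolonomy u p.1 p.2.1.1 p.2.1.2)).trace).re ≤ 4 * δ ^ 4 := fun p => by
    rw [Nat.cast_ofNat, two_sub_re_trace_eq]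
    unfold plaquetteHolonomy
    have e1 : p.1.shift p.2.1.1 = p.1 := Subsingleton.elim _ _
    have e2 : p.1.shift p.2.1.2 = p.1 := Subsingleton.elim _ _
    simp only [e1, e2]
    have h := norm_su2Quat_comm_sub_one_le (u (p.1, p.2.1.1)) (u (p.1, p.2.1.2))
    have h1 := hu (p.1, p.2.1.1)
    have h2 := hu (p.1, p.2.1.2)
    have hb : ‖su2Quat (u (p.1, p.2.1.1) * u (p.1, p.2.1.2) * (u (p.1, p.2.1.1))⁻¹ * (u (p.1, p.2.1.2))⁻¹) - 1‖ ≤ 2 * δ * δ :=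
      h.trans (by nlinarith [mul_le_mul h1 h2 (norm_nonneg _) hδ0, norm_nonneg (su2Quat (u (p.1, p.2.1.1)) - 1)])
    nlinarith [pow_le_pow_left₀ (norm_nonneg _) hb 2]
  refine (Finset.sum_le_sum fun p _ => hp p).trans ?_
  rw [Finset.sum_const, Finset.card_univ, nsmul_eq_mul]
  have hcard : (Fintype.card (Plaquette 3 1) : ℝ) = 3 := by
    rw [Fintype.card_prod, Fintype.card_unique, one_mul]; rfl
  rw [hcard]; ring_nf; rfl

/-! ## §3 The one-site kernel: far pairs are Gaussian-small, the diagonal is `e^{6B}` -/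

omit [NeZero L] in
/-- ★ `K₁^{(B)}(u,u') ≤ exp(B(6 − ‖q(u_k) − q(u'_k)‖²))` for every `k` (`B ≥ 0`). [cite: Luscher1983, §3] -/
theorem transferKernel_one_site_le_exp {B : ℝ} (hB : 0 ≤ B) (u u' : GaugeConfig 3 1 SU2) (k : Fin 3) :
    transferKernel su2Rep B u u' ≤ Real.exp (B * (6 - ‖su2Quat (u (0, k)) - su2Quat (u' (0, k))‖ ^ 2)) := by
  unfold transferKernel timeCoupling
  refine Real.exp_le_exp.mpr ?_
  have hS := add_nonneg (wilsonAction_su2_nonneg_lat u) (wilsonAction_su2_nonneg_lat u')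
  have hsum : ∑ e : Edge 3 1, ((su2Rep (u e * (u' e)⁻¹)).trace).re ≤ 6 - ‖su2Quat (u (0, k)) - su2Quat (u' (0, k))‖ ^ 2 := by
    have he : ∀ e : Edge 3 1, ((su2Rep (u e * (u' e)⁻¹)).trace).re = 2 - ‖su2Quat (u e) - su2Quat (u' e)‖ ^ 2 := fun e =>
      re_trace_su2Rep_mul_inv_eq_norm _ _
    simp only [he, Finset.sum_sub_distrib, Finset.sum_const, Finset.card_univ, card_edge_one, nsmul_eq_mul]
    have h1 : ‖su2Quat (u (0, k)) - su2Quat (u' (0, k))‖ ^ 2 ≤ ∑ e : Edge 3 1, ‖su2Quat (u e) - su2Quat (u' e)‖ ^ 2 :=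
      Finset.single_le_sum (f := fun e : Edge 3 1 => ‖su2Quat (u e) - su2Quat (u' e)‖ ^ 2) (fun _ _ => sq_nonneg _) (Finset.mem_univ (0, k))
    push_cast; linarith
  nlinarith [mul_le_mul_of_nonneg_left hsum hB, mul_nonneg hB hS]

omit [NeZero L] in
/-- The one-site vacuum has zero action. [folklore] -/
theorem wilsonAction_one_site_one : wilsonAction su2Rep (1 : GaugeConfig 3 1 SU2) = 0 := by
  have h := wilsonAction_one_site_le (1 : GaugeConfig 3 1 SU2) (δ := 0) fun e => by simp [su2Quat_one]
  have h0 := wilsonAction_su2_nonneg_lat (L := 1) (1 : GaugeConfig 3 1 SU2)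
  norm_num at h; linarith

omit [NeZero L] in
/-- `K₁^{(B)}(1,1) = e^{6B}`. [folklore] -/
theorem transferKernel_one_site_one_one (B : ℝ) : transferKernel su2Rep B (1 : GaugeConfig 3 1 SU2) 1 = Real.exp (6 * B) := by
  unfold transferKernel timeCoupling
  simp only [Pi.one_apply, inv_one, mul_one, map_one, Matrix.trace_one, Fintype.card_fin, wilsonAction_one_site_one, add_zero, mul_zero, sub_zero,
    Finset.sum_const, Finset.card_univ, card_edge_one]
  norm_num; ring_nf

/-! ## §4 Pinned colour sums have small vector part -/

omit [NeZero L] in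
/-- The imaginary components are bounded by the distance to the real axis: `|q.imI| ≤ ‖q − r·1‖` (and `imJ`, `imK`). [folklore] -/
theorem abs_im_le_norm_sub_smul_one (q : ℍ) (r : ℝ) :
    |q.imI| ≤ ‖q - r • (1 : ℍ)‖ ∧ |q.imJ| ≤ ‖q - r • (1 : ℍ)‖ ∧ |q.imK| ≤ ‖q - r • (1 : ℍ)‖ := by
  have h : ‖q - r • (1 : ℍ)‖ ^ 2 = (q.re - r) ^ 2 + q.imI ^ 2 + q.imJ ^ 2 + q.imK ^ 2 := by
    rw [sq, ← Quaternion.normSq_eq_norm_mul_self, Quaternion.normSq_def']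
    simp [Quaternion.re_sub, Quaternion.imI_sub, Quaternion.imJ_sub, Quaternion.imK_sub]
  have hn := norm_nonneg (q - r • (1 : ℍ))
  refine ⟨abs_le_of_sq_le_sq' (by nlinarith [sq_nonneg (q.re - r), sq_nonneg q.imJ, sq_nonneg q.imK]) hn |> fun h => abs_le.mpr h,
    abs_le_of_sq_le_sq' (by nlinarith [sq_nonneg (q.re - r), sq_nonneg q.imI, sq_nonneg q.imK]) hn |> fun h => abs_le.mpr h,
    abs_le_of_sq_le_sq' (by nlinarith [sq_nonneg (q.re - r), sq_nonneg q.imI, sq_nonneg q.imJ]) hn |> fun h => abs_le.mpr h⟩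

/-- ★ **Pinned colour sum ⇒ small total vector part**: `‖Σ_x g⃗_x‖_∞ ≤ ‖S − ‖S‖·1‖` (`S = Σ_x q(g_x)`). [folklore] -/
theorem norm_sum_vecPart_le (g : Site 3 L → SU2) : ‖∑ x : Site 3 L, vecPart (g x)‖ ≤ ‖colourQuatSum L g - ‖colourQuatSum L g‖ • (1 : ℍ)‖ := by
  have h := abs_im_le_norm_sub_smul_one (colourQuatSum L g) ‖colourQuatSum L g‖
  have hI : (colourQuatSum L g).imI = ∑ x : Site 3 L, (su2Quat (g x)).imI := by
    unfold colourQuatSum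
    rw [show (∑ x : Site 3 L, su2Quat (g x)).imI = QuaternionAlgebra.imIₗ _ _ _ (∑ x : Site 3 L, su2Quat (g x)) from rfl, map_sum]; rfl
  have hJ : (colourQuatSum L g).imJ = ∑ x : Site 3 L, (su2Quat (g x)).imJ := by
    unfold colourQuatSum
    rw [show (∑ x : Site 3 L, su2Quat (g x)).imJ = QuaternionAlgebra.imJₗ _ _ _ (∑ x : Site 3 L, su2Quat (g x)) from rfl, map_sum]; rfl
  have hK : (colourQuatSum L g).imK = ∑ x : Site 3 L, (su2Quat (g x)).imK := by
    unfold colourQuatSum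
    rw [show (∑ x : Site 3 L, su2Quat (g x)).imK = QuaternionAlgebra.imKₗ _ _ _ (∑ x : Site 3 L, su2Quat (g x)) from rfl, map_sum]; rfl
  refine (pi_norm_le_iff_of_nonneg (norm_nonneg _)).mpr fun c => ?_
  rw [Real.norm_eq_abs, Finset.sum_apply]
  fin_cases c
  · show |∑ x : Site 3 L, (su2Quat (g x)).imI| ≤ _
    rw [← hI]; exact h.1
  · show |∑ x : Site 3 L, (su2Quat (g x)).imJ| ≤ _
    rw [← hJ]; exact h.2.1
  · show |∑ x : Site 3 L, (su2Quat (g x)).imK| ≤ _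
    rw [← hK]; exact h.2.2

end Summit.QuantumFields.YangMills.Theorems.FemtoTransferGap.TwoLattice.ConstTube

end
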